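import Summits.QuantumFields.BalabanUV.Beta.GAN24.RespInnerBondKernel

/-!
# `BalabanUV.Beta.GAN24.ConstantSlotGaugeTower` — binder row G-an2-4 ∕ (CONV-C), W-slot (α-0), ROW (C) AT LEVELS `j ≥ 1`, first letter of (W4)∕(W7) of the (γ) hand's memo
# `HOME/b2b-balaban-gan24-formalise-leaf-06/g52/C-LEVELS-GE1.md` §22: **THE FULL SLOT SUM OF THE VALUE THIRD JET IS THE MULTIPLIER-LEG BLOCK OF THE SANDWICHED GAUGE STENCIL —
# `Σ'_t (e3OfK Lc G_j S ν t)(x, z)_{inl a, inl b} = −(G_j ∘ 𝒮_ν[S] ∘ G_j)(Lc•x, Lc•z)_{inr a, inr b}`, `𝒮_ν[S] = c₀σ_j(1,1)·Σ'_{t′} χ_ν(t′)·S ν t′`** — the constant-gauge direction of the slot,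
# every `j`, in-block root `toSite r`, every `d`, `Lc ≥ 1`, any local stencil family `S` (G-an2-4 CRUX TEAM (2), seat `b2b-balaban-gan24-formalise-leaf-06` = the (γ) hand, gen 52;
# journal INTENT I-leaf06-g52-13 + ADD-4)

NOT IN PRINT; OUR BOOKKEEPING ([folklore] BY NAME: leaf-04's `RespInnerBondKernel.hasSum_comp_comp_family_bond` (the two one-sided Fubinis through the sandwich) and
`DressedHalfVertex.hasSum_vertexOfK_dressedStep` (the resummed chain-rule vertex selects the exit face), an2's `ValueJetGeneric.e3OfK_apply` ∕ `vertexFamily_vertexOfK`,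
`HessKerDressedUnits.unitK_one`, `BalabanStepJetsSucc.mmRead_inl_inl`; 0 `def`, 0 cited fact, 0 `def … : Prop`, 0 sorry).
HONEST FRAMING (cell contract, verbatim): «discharging `BetaPertH` makes Bałaban's UV stability UNCONDITIONAL — a real constructive-QFT result; it is NOT the continuum
limit and NOT the Clay problem.»  HONEST DEPENDENCY (verbatim): «continuum YM on T⁴ ⇐ BetaPertH ∧ nine spine estimates (0/9 proved); BetaPertH ⇐ (D1) ∧ (D4) ∧ CAP+tail;
G-an2-4 gates asym, D1 and NE2/3/4.»
* §1 **`hasSum_slot_e3OfK_inl_inl`**, `tsum_slot_e3OfK_inl_inl` — the identity above (pointwise `HasSum` in the slot `t`).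
* §2 **`towerSlot_faceRead`** — the tower slot `τ_R` of the comb table `SrecAt … j` (any pins) as an exit-face read of that multiplier block.
WHERE IT SITS: the tower slots `τ_R(b,z) = Σ'_{s′} χ_β(s′)·Σ'_t V_j ν t z s′ (inl b)(inl β)`, `τ_L` of `ExchangeE2E2Channel.exchangeWord_sector_eq` (the three `τ` pairings left open by (W6))
are exit-face reads of THIS kernel's multiplier-leg block; `S = SrecAt … j` then descends one level by `SpureRecAt_succ` (memo §22 STEP 3). Asserts NO value of Bałaban's tables;
discharges NOTHING of (C) ∕ (C)sym ∕ (Q-L) ∕ «T2Shape» ∕ «T2Drift» ∕ (hW, hWall); NEVER «G-an2-4 closed» as (CONV-C); NOT D1, NOT `BetaPertH`, NOT continuum, NOT Clay.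
2026-08-23; no existing file touched.
-/

noncomputable section

open Finset
open scoped BigOperators
open Literature.MathematicalPhysics.QuantumFieldTheory
open Literature.MathematicalPhysics.QuantumFieldTheory.Balaban1983to89
open Literature.MathematicalPhysics.QuantumFieldTheory.Balaban1983to89.Beta
open ExpKernelCalculus (Site MKer Decays VertexFamily comp)
open OneStepResolventKernel (Fib LocStencil)
open OneStepKernelFamily (KInvStep vertexOfK vertexFamily_vertexOfK)
open AffineAveraging (box toSite)
open BalabanStepJetsSucc (mmRead mmRead_inl_inl)
open Summit.QuantumFields.BalabanUV.Beta.AxialDressingRooted (coDressKBmAt decays_coDressKBmAt_KInvStep one_le_of_neZero)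
open Summit.QuantumFields.BalabanUV.Beta.HessKerDressedUnits (unitK unitK_one)
open Summit.QuantumFields.BalabanUV.Beta.SpineRooted (e3OfK e3OfK_apply)
open Summit.QuantumFields.BalabanUV.Beta.WardLocusRecursive (SrecAt locStencil_SrecAt)
open Summit.QuantumFields.BalabanUV.Beta.GAN24.DressedHalfVertex (hasSum_vertexOfK_dressedStep)
open Summit.QuantumFields.BalabanUV.Beta.GAN24.RespInnerBondKernel (hasSum_comp_comp_family_bond)

namespace Summit.QuantumFields.BalabanUV.Beta.GAN24.ConstantSlotGaugeTower

variable {d : ℕ} {Lc : ℕ} [NeZero Lc] {r : Fin (d + 1) → ℕ}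
variable {S : Fin (d + 1) → (Fin (d + 1) → ℤ) → MKer (d + 1) (Fib d)}

/-! ## §1 The full slot sum of the value third jet -/

/-- [folklore] **THE FULL SLOT SUM OF THE VALUE THIRD JET IS THE MULTIPLIER-LEG BLOCK OF THE SANDWICHED GAUGE STENCIL** (every `j`, in-block root, any local `S`):
`HasSum (t ↦ (e3OfK Lc G_j S ν t)(x, z)_{inl a, inl b}) (−(G_j ∘ 𝒮_ν ∘ G_j)(Lc•x, Lc•z)_{inr a, inr b})`, `𝒮_ν p q c e = (Lc·(1·1))·((Lc^{j+1})^{d+2})⁻¹·Σ'_{t′} [t′_ν % Lc = Lc−1]·S ν t′ p q c e` —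
`e3OfK = −mmRead (G ∘ vertexOfK ∘ G)` read on field legs is the multiplier block at dilated points; the bond family `t ↦ G ∘ vertexOfK_t ∘ G` sums through the sandwich
(`hasSum_comp_comp_family_bond`) to `G ∘ (Σ_t vertexOfK_t) ∘ G`, and `Σ_t vertexOfK_t = 𝒮_ν` (`hasSum_vertexOfK_dressedStep` at unit scales, `unitK_one`). -/
theorem hasSum_slot_e3OfK_inl_inl (hr : r ∈ box (d + 1) Lc) {Cs δs : ℝ} (hS : LocStencil S Cs δs) (hδs : 0 < δs) (j : ℕ) (ν : Fin (d + 1)) (x z : Site (d + 1))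
    (a b : Fin (d + 1)) :
    HasSum (fun t : Site (d + 1) => e3OfK Lc (coDressKBmAt (toSite r) Lc (KInvStep (d := d) Lc j)) S ν t x z (Sum.inl a) (Sum.inl b))
      (-(comp (comp (coDressKBmAt (toSite r) Lc (KInvStep (d := d) Lc j))
          (fun p q c e => ((Lc : ℝ) * ((1 : ℝ) * 1)) * ((((Lc ^ (j + 1) : ℕ) : ℝ)) ^ (d + 1 + 1))⁻¹ *
            ∑' t : Site (d + 1), (if t ν % (Lc : ℤ) = (Lc : ℤ) - 1 then S ν t p q c e else 0)))
          (coDressKBmAt (toSite r) Lc (KInvStep (d := d) Lc j)) ((Lc : ℤ) • x) ((Lc : ℤ) • z) (Sum.inr a) (Sum.inr b))) := by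
  have hLc : 1 ≤ Lc := one_le_of_neZero Lc
  set G := coDressKBmAt (toSite r) Lc (KInvStep (d := d) Lc j) with hGdef
  obtain ⟨δG, CG, hδG, hCG, hG⟩ := decays_coDressKBmAt_KInvStep (d := d) hr j
  rw [← hGdef] at hG
  -- common rate
  set m : ℝ := min δG δs with hm
  have hm0 : 0 < m := lt_min hδG hδs
  have hCs : 0 ≤ Cs := (hS 0 0).nonneg (Sum.inl 0)
  have hSm : LocStencil S Cs m := BalabanStepJets.locStencil_mono hS hCs (min_le_right _ _)
  have hVF : VertexFamily (vertexOfK G Lc S) Lc _ (m / 2) := vertexFamily_vertexOfK (N := Lc) hG hCG hSm hm0 (min_le_left _ _)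
  have hG' : Decays G (|CG|) (m / 2) := TameKernelCalculus.decays_of_le hG (by linarith [min_le_left δG δs] : m / 2 ≤ δG)
  -- the bond sum of the vertex: the gauge stencil (unit scales)
  have hW : ∀ (s s' : Site (d + 1)) (g g' : Fib d), HasSum (fun t : Site (d + 1) => vertexOfK G Lc S ν t s s' g g')
      (((Lc : ℝ) * ((1 : ℝ) * 1)) * ((((Lc ^ (j + 1) : ℕ) : ℝ)) ^ (d + 1 + 1))⁻¹ *
        ∑' t : Site (d + 1), (if t ν % (Lc : ℤ) = (Lc : ℤ) - 1 then S ν t s s' g g' else 0)) := by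
    intro s s' g g'
    have h := hasSum_vertexOfK_dressedStep hLc hr 1 1 j ν hS hδs s s' g g'
    rwa [unitK_one, ← hGdef] at h
  have hfam := hasSum_comp_comp_family_bond (N := Lc) hG' (half_pos hm0) (V := fun t => vertexOfK G Lc S ν t) (fun t => hVF ν t) hW
    ((Lc : ℤ) • x) ((Lc : ℤ) • z) (Sum.inr a) (Sum.inr b)
  have hfun : (fun t : Site (d + 1) => e3OfK Lc G S ν t x z (Sum.inl a) (Sum.inl b)) =
      fun t : Site (d + 1) => -(comp (comp G (vertexOfK G Lc S ν t)) G ((Lc : ℤ) • x) ((Lc : ℤ) • z) (Sum.inr a) (Sum.inr b)) := by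
    funext t
    rw [e3OfK_apply, mmRead_inl_inl]
  rw [hfun]
  exact hfam.neg

/-- [folklore] `tsum` form of `hasSum_slot_e3OfK_inl_inl`. -/
theorem tsum_slot_e3OfK_inl_inl (hr : r ∈ box (d + 1) Lc) {Cs δs : ℝ} (hS : LocStencil S Cs δs) (hδs : 0 < δs) (j : ℕ) (ν : Fin (d + 1)) (x z : Site (d + 1))
    (a b : Fin (d + 1)) :
    ∑' t : Site (d + 1), e3OfK Lc (coDressKBmAt (toSite r) Lc (KInvStep (d := d) Lc j)) S ν t x z (Sum.inl a) (Sum.inl b) =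
      -(comp (comp (coDressKBmAt (toSite r) Lc (KInvStep (d := d) Lc j))
          (fun p q c e => ((Lc : ℝ) * ((1 : ℝ) * 1)) * ((((Lc ^ (j + 1) : ℕ) : ℝ)) ^ (d + 1 + 1))⁻¹ *
            ∑' t : Site (d + 1), (if t ν % (Lc : ℤ) = (Lc : ℤ) - 1 then S ν t p q c e else 0)))
          (coDressKBmAt (toSite r) Lc (KInvStep (d := d) Lc j)) ((Lc : ℤ) • x) ((Lc : ℤ) • z) (Sum.inr a) (Sum.inr b)) :=
  (hasSum_slot_e3OfK_inl_inl hr hS hδs j ν x z a b).tsum_eq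

/-! ## §2 The tower slot of the comb table, read at an exit face -/

/-- [folklore] **THE TOWER SLOT OF (W6)'s OPEN PAIRINGS IS AN EXIT-FACE READ OF THE MULTIPLIER BLOCK** (comb table `SrecAt … j`, any pins, every `j`, in-block root):
`τ_R(b,z) = Σ'_{s′} χ_β(s′)·Σ'_t (e3OfK Lc G_j (SrecAt … j) ν t)(z, s′)_{inl b, inl β} = Σ'_{s′} χ_β(s′)·(−(G_j ∘ 𝒮_ν[SrecAt … j] ∘ G_j))(Lc•z, Lc•s′)_{inr b, inr β}` (§1 with leaf-10's
`locStencil_SrecAt`). -/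
theorem towerSlot_faceRead (hr : r ∈ box (d + 1) Lc) (cE cVH cΛ : ℝ) (j : ℕ) (ν β b : Fin (d + 1)) (z : Site (d + 1)) :
    (∑' s' : Site (d + 1), (if s' β % (Lc : ℤ) = (Lc : ℤ) - 1 then
        ∑' t : Site (d + 1), e3OfK Lc (coDressKBmAt (toSite r) Lc (KInvStep (d := d) Lc j)) (SrecAt d Lc (toSite r) cE cVH cΛ j) ν t z s' (Sum.inl b) (Sum.inl β)
        else 0)) =
      ∑' s' : Site (d + 1), (if s' β % (Lc : ℤ) = (Lc : ℤ) - 1 then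
        -(comp (comp (coDressKBmAt (toSite r) Lc (KInvStep (d := d) Lc j))
            (fun p q c e => ((Lc : ℝ) * ((1 : ℝ) * 1)) * ((((Lc ^ (j + 1) : ℕ) : ℝ)) ^ (d + 1 + 1))⁻¹ *
              ∑' t : Site (d + 1), (if t ν % (Lc : ℤ) = (Lc : ℤ) - 1 then SrecAt d Lc (toSite r) cE cVH cΛ j ν t p q c e else 0)))
            (coDressKBmAt (toSite r) Lc (KInvStep (d := d) Lc j)) ((Lc : ℤ) • z) ((Lc : ℤ) • s') (Sum.inr b) (Sum.inr β))
        else 0) := by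
  obtain ⟨Cs, δs, hδs, hS⟩ := locStencil_SrecAt (d := d) (one_le_of_neZero Lc) hr cE cVH cΛ j
  refine tsum_congr fun s' => ?_
  split_ifs
  · rw [tsum_slot_e3OfK_inl_inl hr hS hδs j ν z s' b β]
  · rfl

end Summit.QuantumFields.BalabanUV.Beta.GAN24.ConstantSlotGaugeTower

end
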